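import Mathlib.Analysis.SpecialFunctions.Pow.Real
import Mathlib.Analysis.SpecialFunctions.Pow.Asymptotics
import Mathlib.Analysis.SpecialFunctions.Log.Basic
import Literature.NumberTheory.Sieve.BatemanHorn
import HarnessLib
import HarnessLib.Audit

/-!
# Barrier catalogue `Parity`: the Bateman–Horn / quantitative Hypothesis H asymptotic is NOT
# uniform in the polynomial at the scale `x ≍ (log height)^B` — in every degree
# (Friedlander–Granville 1991, Nair–Perelli 1995, via Maier's matrix; Granville, ICM 1994)

Catalogue entry (D-0021) for the summit `Parity`, sub-problem `BatemanHorn`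
(`Literature.NumberTheory.Sieve.BatemanHornConjecture`, one irreducible polynomial `f` of degree `d`). The degree-one case —
the prime number theorem for progressions `qX + a` is not uniform in `q < x / log^N x` — is the
tree entry `Literature/Barriers/Parity/FriedlanderGranvilleUniformity.lean`
(`Literature.Barriers.Parity.FriedlanderGranvilleUniformityBarrier`, Friedlander–Granville part III); it is cited,
not restated. THIS entry records part IV of the same series and its sequel by Nair–Perelli: for
EVERY degree `d ≥ 1` and every fixed `B > 0` there are irreducible polynomials `f` of degree `d`
without fixed prime divisor, of arbitrarily large height `h(f)`, taking significantly more or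
significantly fewer prime values `f(n)`, `n ≤ x`, `x ≥ (log h(f))^B`, than the Bateman–Horn /
Hypothesis-H prediction `C_f ∑_{n ≤ x} 1/log|f(n)|`. So the conjectured asymptotic cannot be
upgraded to a statement uniform in the coefficients at that scale, "which is somewhat ironic since
it is not known that any polynomial of degree `≥ 2` takes on infinitely many prime values"
(Granville).

* `polyHeight f = (∑ᵢ cᵢ²)^{1/2}` (Granville's height), `primeValueCount f x = #{1 ≤ n ≤ x :
  |f(n)| prime}` (`π_f(x)`), `invLogSum f x = ∑_{n=1}^{x} 1/log|f(n)|` (the Cramér expected count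
  divided by `C_f`);
* `UniformHypothesisHLogPower d B` — "the asymptotic formula of Hypothesis H holds uniformly over
  irreducible `f` of degree `d` without fixed prime divisor in the range `x ≥ (log h(f))^B`" — the
  uniformity CLASS the barrier refutes (an explicit `Prop`, so that it can be attacked);
* `UniformBatemanHornBarrier` — the named fact `∀ d ≥ 1, ∀ B > 0, ¬ UniformHypothesisHLogPower d B`,
  carrying the structured BARRIER block; `uniformBatemanHornBarrier_iff` unfolds it into the
  printed `Ω`-form (infinitely many polynomials with a deviation by a constant factor), and
  `uniformBatemanHornBarrier_iff_nat` shows that quantifying over integers `N ≥ 2` (the form of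
  the Zbl review of Friedlander–Granville IV) or over reals `B > 0` (Granville's form) is the same;
* `GranvilleUniformityConjecture` — Granville's positive conjecture (uniformity for `x > h(f)^η`),
  a registered OPEN CONJECTURE in the sense of CONVENTIONS §4 (docstring
  `OPEN CONJECTURE — … [status: open]`), not named-fact debt: the tenured prove-seat's verdict
  `open-problem` was re-verified on the page in the verdict clean-up of 2026-08-16 — the statement
  is printed as "**Conjecture**" ("to be safe, we only make the following prediction") at the end
  of Granville's survey (Proc. ICM Zürich 1994, printed p. 397 = author's version p. 10), proved
  nowhere, and it contains Bunyakovsky's conjecture (sibling `UniformBatemanHornBunyakovsky.lean`),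
  so there is no `GranvilleUniformityConjecture_holds` to expect; the Lean statement (case `k = 1`,
  fixed degree) is faithful. The name is KEPT (it already carries the suffix `Conjecture` and has
  users in the sibling files `UniformBatemanHornProofs.lean`, `UniformBatemanHornBunyakovsky.lean`).
  Proved next to it: the comparison `UniformHypothesisHLogPower.of_logPower_range` — log-power
  uniformity would imply it, so the barrier and the conjecture concern disjoint regimes.

## What the sources print (verified on the page)

* A. Granville, *Unexpected irregularities in the distribution of prime numbers*, Proc. ICM Zürich
  1994, Vol. I, 388–399 (read in the author's version, 12 pp.)
  [cite: Granville1995Irregularities, Hypothesis H; "The Maier Matrix for π_F(y)"; Conjecture].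
  p. 3, **Hypothesis H**: "Let `F = {f₁(x), …, f_k(x)}` be a set of irreducible polynomials with
  integer coefficients. Then the number of integers `n ≤ x` for which each `|f_j(n)|` is prime is
  `π_F(x) = {C_F + o(1)} x / (log|f₁(x)| log|f₂(x)| ⋯ log|f_k(x)|)`, where
  `C_F = ∏_p (1 − ω_F(p)/p) / (1 − 1/p)^k`, and `ω_F(p)` counts the number of integers `n`, in
  the range `1 ≤ n ≤ p`, for which `f₁(n)⋯f_k(n) ≡ 0 (mod p)`." p. 5, (7) (Maier 1985):
  `π(x₊ + log^B x₊) − π(x₊) > (1 + δ_B) log^{B−1} x₊` and `π(x₋ + log^B x₋) − π(x₋) < (1 − δ_B) log^{B−1} x₋`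
  "for occasional, but arbitrarily large, values of `x₊` and `x₋`"; "Outline of the Proof":
  `Φ(y, z) := #{1 ≤ n ≤ y : p ∣ n ⇒ p > z} ∼ ω(u) y / log z` for `y = z^u`, "`ω(u) − e^{−γ}`
  oscillates, crossing zero either once or twice in every interval of length 1", and the Maier
  matrix `(R+i)P + j`. pp. 9–10: "Finding primes in `(x, x+y]` is equivalent to finding integers
  `n ≤ y` for which `f(n)` is prime, where `f(t)` is the polynomial `t + x`. Similarly, finding
  primes `≤ x` which belong to the arithmetic progression `a (mod q)`, is equivalent to finding
  integers `n ≤ y := x/q` for which `f(n)` is prime, where `f(t)` is the polynomial `qt + a`. Define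
  the height, `h(f)`, of a given polynomial `f(t) = ∑ᵢ cᵢtⁱ` to be `h(f) := (∑ᵢ cᵢ²)^{1/2}`. In the
  cases above, in which the degree is always 1, we proved that we do not always get the
  asymptotically expected number of prime values `f(n)` with `n ≤ y = log^B h(f)`, for any fixed
  `B > 0`. In [9] we showed that this is true for polynomials of arbitrary degree `d`, which is
  somewhat ironic since it is not known that any polynomial of degree `≥ 2` takes on infinitely
  many prime values, nor that the prime values are ever 'well-distributed'. Nair and Perelli [18]
  showed that some of the polynomials `F_R(n) = n^d + RP` attain more than, and others attain less
  than, the number of prime values expected in such a range, by considering the following Maier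
  matrix: [`(i, j)`th entry `F_{R+i}(j)`]. Notice that the `j`th column here is part of the
  arithmetic progression `j^d (mod P)`." … "We have now seen that the asymptotic formula in
  Hypothesis H fails when `x` is an arbitrary fixed power of `log h(F)` (`:= ∑ᵢ log h(fᵢ)`), for
  many different non-trivial examples `F`. Presumably the asymptotic formula does hold uniformly
  as `log x / log log h(F) → ∞`. However, to be safe, we only make the following prediction:
  **Conjecture.** Fix `ε > 0` and positive integer `k`. The asymptotic formula in Hypothesis H holds
  uniformly for `x > h(F)^ε` as `h(F) → ∞`." "Our work here shows that the 'random-like' behaviour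
  exhibited by primes in many situations does not carry over to all situations." ([9] =
  Friedlander–Granville IV, [18] = Nair–Perelli.)
* J. Friedlander, A. Granville, *Limitations to the equi-distribution of primes. IV*, Proc. Roy.
  Soc. London A 435 (1991), 197–204 [cite: FriedlanderGranville1991, Abstract and Theorem (as reviewed in Zbl 0736.11049)].
  NOT HELD (paywalled; acquisition request acq-00343). Abstract (publisher metadata): "We
  construct infinitely many different polynomials of given degree which take either significantly
  more or significantly less prime values than expected." Zbl 0736.11049 (D. R. Heath-Brown):
  "Let `F ∈ ℤ[X]` be irreducible, with no fixed factor, and let `|F(n)|` take `π_F(x)` prime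
  values for `n ≤ x`. It is conjectured that `π_F(x) ∼ C_F x / log|F(x)|` (*) with a certain
  explicit constant `C_F > 0`. The present paper shows that this cannot hold with too great a
  degree of uniformity in `|F|`, the maximum coefficient of `F`. Specifically, it is shown that,
  for any integer `N ≥ 2`, the formula (*) cannot hold uniformly for `x ≥ log^N |F|`, even if one
  fixes the degree of `F`. The paper also proves an `Ω_±` result, but here the Riemann hypothesis
  for appropriate Dedekind zeta-functions must be assumed. The paper follows the method of
  H. Maier … Here, however, care must also be exercised in the choice of polynomials to be used."
* M. Nair, A. Perelli, *On the prime ideal theorem and irregularities in the distribution of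
  primes*, Duke Math. J. 77 (1995), 1–20 [cite: NairPerelli1995, main theorem (as reviewed in Zbl 0818.11035)]. NOT HELD
  (paywalled; acquisition requested). Zbl 0818.11035 (J. Hinz): for `f(x) = x^k + Qd`,
  `ρ(d, p) = |{m mod p : m^k + Qd ≡ 0 mod p}|`, `r(d)` = number of irreducible factors of `f`:
  "`∑_{Y ≤ d ≤ Y+H} |∑_{X ≤ p ≤ 2X} (ρ(d, p) − r(d))| ≪_{A,k,ε} X·H / log^A X` uniformly for
  `Q ≤ Y^A`, `A > 0`, provided that `Y^{1/2+ε} ≤ H ≤ Y`. This result has an interesting application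
  concerning a theorem of Friedlander–Granville [part IV] on irregularities in the distribution of
  primes represented by polynomials."
* A. N. Skorobogatov, E. Sofos, *Schinzel Hypothesis with probability 1 and rational points*,
  arXiv:2005.02998 (= Invent. Math. 231 (2023)) [cite: SkorobogatovSofos2020, Theorems 1.5, 1.9 and Corollary 1.6].
  p. 4: `S_C(P) := {m ∈ ℕ : m ≤ (log |P|)^C, m ≡ n₀ (mod M), Pᵢ(m) prime}`; Theorem 1.5: "Fix
  `A > 0`. … for all `H ≥ 3` we have `#{P ∈ Poly(H) : P Schinzel, #S_{n+A}(P) ≥ (log |P|)^{A/3}}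
  / #{P ∈ Poly(H) : P Schinzel} = 1 + O((log log log H)^{d−n} / √(log log H))`"; Corollary 1.6:
  "For 100% of degree `d` Bouniakowsky polynomials `P` the least prime represented by `P` is at
  most `|P| (log |P|)^{d+ε}`." p. 5, Theorem 1.9 (with `θ_P(x) = ∑_{m ≤ x, Pᵢ(m) prime} ∏ log Pᵢ(m)`,
  `𝔖_P(x)` the singular series truncated at `ℓ ≤ log x`,
  `𝓡(x, H) = #Poly(H)⁻¹ ∑_{P ∈ Poly(H)} |θ_P(x) − 𝔖_P(x) x|`): "Fix arbitrary `A₁, A₂ ∈ ℝ` with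
  `n < A₁ < A₂`. Then for all `H ≥ 3` and all `x ≥ 3` with `(log H)^{A₁} < x ≤ (log H)^{A₂}` we
  have `𝓡(x, H) ≪ x / √log x`"; "one cannot expect typical polynomials to represent primes when
  the input is not large compared to the coefficients, and `m ≈ (log |P|)^n` seems to be a
  natural barrier." p. 6: "The work of Friedlander–Granville [part IV] has special interest in
  connection to our work as it shows that there are unexpectedly large fluctuations in the error
  term of the Bateman–Horn asymptotic".

## Design notes

* "The asymptotically expected number of prime values `f(n)` with `n ≤ x`" is rendered by the
  Cramér sum `C_f · ∑_{n=1}^{x} 1/log|f(n)|` (`invLogSum`) rather than by the endpoint form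
  `C_f x / log|f(x)|` of the displayed formulas: the two agree to leading order for fixed `f` as
  `x → ∞` and in the large-coefficient regime of the sources (where `log|f(n)| = (1 + o(1)) log h(f)`
  for all `n ≤ x`), but the endpoint form degenerates whenever `|f(x)| ≤ 1` (e.g.
  `f = (X − N)² + 1` at `x = N`), which would make the uniform statement false for a reason
  unrelated to the sources and the barrier provable by a junk value. Terms with `|f(n)| ≤ 1`
  contribute `1 / log 0 = 1 / log 1 = 0`.
* `π_f(x)` counts `1 ≤ n ≤ x` with `|f(n)|` prime (both sources use `|f(n)|`); the tree's
  `Literature.polyPrimeCount ![f] x` counts `0 ≤ n ≤ x` with `f(n) > 0` prime and is not used here.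
  `C_f` is the tree's ordered Bateman–Horn constant: `Literature.HasBatemanHornConst ![f] C`
  (`k = 1`: `∏_p (1 − 1/p)⁻¹ (1 − ω_f(p)/p)`, Granville's `C_F`). Polynomials for which the
  product does not converge impose no condition in `UniformHypothesisHLogPower` (for irreducible
  `f` it converges by the prime ideal theorem, tree fact `Literature.NumberTheory.Sieve.exists_hasBatemanHornConst`).
* Uniformity is "as `h(f) → ∞`" (`∃ h₀, ∀ f` with `h(f) ≥ h₀`), the reading under which the
  sources' negation ("infinitely many different polynomials") is exactly `¬`; with an `x₀`-threshold
  instead, the uniform statement would be stronger and the barrier weaker.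
-/

noncomputable section

open Filter Finset Polynomial Asymptotics

namespace Literature.Barriers.Parity

/-! ### Objects -/

/-- Granville's height of an integer polynomial, `h(f) = (∑ᵢ cᵢ²)^{1/2}`.
[cite: Granville1995Irregularities, "The Maier Matrix for π_F(y)" (definition of h(f))] -/
def polyHeight (f : ℤ[X]) : ℝ :=
  Real.sqrt (∑ i ∈ range (f.natDegree + 1), ((f.coeff i : ℤ) : ℝ) ^ 2)

/-- `π_f(x) = #{1 ≤ n ≤ x : |f(n)| is prime}`, the prime-value counting function of one
polynomial (Granville's `π_F(x)` for `F = {f}`; Friedlander–Granville's `π_F(x)`).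
[cite: Granville1995Irregularities, Hypothesis H] [cite: FriedlanderGranville1991, (Zbl 0736.11049)] -/
def primeValueCount (f : ℤ[X]) (x : ℕ) : ℕ :=
  #((Icc 1 x).filter fun n : ℕ => (f.eval (n : ℤ)).natAbs.Prime)

/-- `E_f(x) = ∑_{n=1}^{x} 1 / log|f(n)|`, the Cramér expected number of prime values divided by
`C_f` (terms with `|f(n)| ≤ 1` are `0`). See the design notes for its relation to the printed
`x / log|f(x)|`. [cite: Granville1995Irregularities, Hypothesis H] -/
def invLogSum (f : ℤ[X]) (x : ℕ) : ℝ :=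
  ∑ n ∈ Icc 1 x, 1 / Real.log (((f.eval (n : ℤ)).natAbs : ℕ) : ℝ)

/-- Unfolding lemma for `primeValueCount`. [folklore] -/
theorem primeValueCount_def (f : ℤ[X]) (x : ℕ) :
    primeValueCount f x = #((Icc 1 x).filter fun n : ℕ => (f.eval (n : ℤ)).natAbs.Prime) := rfl

/-- Unfolding lemma for `invLogSum`. [folklore] -/
theorem invLogSum_def (f : ℤ[X]) (x : ℕ) :
    invLogSum f x = ∑ n ∈ Icc 1 x, 1 / Real.log (((f.eval (n : ℤ)).natAbs : ℕ) : ℝ) := rfl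

/-- `E_f(x) ≥ 0` (each term is `1 / log m` with `m ∈ ℕ`, and `log m ≥ 0`). [folklore] -/
theorem invLogSum_nonneg (f : ℤ[X]) (x : ℕ) : 0 ≤ invLogSum f x :=
  sum_nonneg fun _ _ => div_nonneg zero_le_one (Real.log_natCast_nonneg _)

/-- `π_f(x) ≤ x`. [folklore] -/
theorem primeValueCount_le (f : ℤ[X]) (x : ℕ) : primeValueCount f x ≤ x := by
  unfold primeValueCount
  exact (card_filter_le _ _).trans (by simp)

/-- Sanity check of the counting convention (`1 ≤ n ≤ x`, `|f(n)|` prime): among `1 ≤ n ≤ 4`,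
`n² + 1 ∈ {2, 5, 10, 17}` is prime exactly three times. [folklore] -/
theorem primeValueCount_X_sq_add_one_four : primeValueCount (X ^ 2 + 1) 4 = 3 := by
  unfold primeValueCount
  simp only [eval_add, eval_pow, eval_X, eval_one]
  decide

/-- `h(f) ≥ 0`. [folklore] -/
theorem polyHeight_nonneg (f : ℤ[X]) : 0 ≤ polyHeight f := Real.sqrt_nonneg _

/-- A non-zero integer polynomial has height `≥ 1` (its leading coefficient is a non-zero
integer). [folklore] -/
theorem one_le_polyHeight {f : ℤ[X]} (hf : f ≠ 0) : 1 ≤ polyHeight f := by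
  unfold polyHeight
  rw [← Real.sqrt_one]
  refine Real.sqrt_le_sqrt ?_
  have hmem : f.natDegree ∈ range (f.natDegree + 1) := by simp
  refine le_trans ?_ (single_le_sum (f := fun i => ((f.coeff i : ℤ) : ℝ) ^ 2)
    (fun i _ => sq_nonneg _) hmem)
  have hlc : f.coeff f.natDegree ≠ 0 := by
    rw [Polynomial.coeff_natDegree]
    exact Polynomial.leadingCoeff_ne_zero.mpr hf
  have h1 : (1 : ℝ) ≤ |((f.coeff f.natDegree : ℤ) : ℝ)| := by
    rw [← Int.cast_abs]
    exact_mod_cast Int.one_le_abs hlc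
  calc (1 : ℝ) = 1 ^ 2 := by norm_num
    _ ≤ |((f.coeff f.natDegree : ℤ) : ℝ)| ^ 2 := by gcongr
    _ = ((f.coeff f.natDegree : ℤ) : ℝ) ^ 2 := sq_abs _

/-- Hence `log h(f) ≥ 0` for `f ≠ 0`. [folklore] -/
theorem log_polyHeight_nonneg {f : ℤ[X]} (hf : f ≠ 0) : 0 ≤ Real.log (polyHeight f) :=
  Real.log_nonneg (one_le_polyHeight hf)

/-! ### The uniformity class -/

/-- **"The asymptotic formula in Hypothesis H holds uniformly in the range `x ≥ (log h(f))^B`"**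
for single irreducible polynomials of degree `d` without fixed prime divisor: for every `ε > 0`
there is `h₀` such that every such `f` of height `h(f) ≥ h₀`, every `x ≥ (log h(f))^B` and the
Bateman–Horn constant `C_f` (`Literature.HasBatemanHornConst ![f] C_f`) satisfy
`|π_f(x) − C_f E_f(x)| ≤ ε C_f E_f(x)`, `E_f(x) = ∑_{n ≤ x} 1/log|f(n)|`. This is the uniformity
whose failure Friedlander–Granville (part IV) and Granville's survey print ("(*) cannot hold
uniformly for `x ≥ log^N |F|`"; "we do not always get the asymptotically expected number of prime
values `f(n)` with `n ≤ y = log^B h(f)`"). The technique class of the barrier: any method whose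
output is (or implies) this uniform statement.
[cite: FriedlanderGranville1991, (Zbl 0736.11049)] [cite: Granville1995Irregularities, "The Maier Matrix for π_F(y)"] -/
def UniformHypothesisHLogPower (d : ℕ) (B : ℝ) : Prop :=
  ∀ ε : ℝ, 0 < ε → ∃ h₀ : ℝ, ∀ f : ℤ[X], f.natDegree = d → Irreducible f →
    Literature.NumberTheory.Sieve.HasNoFixedPrimeDivisor ![f] → h₀ ≤ polyHeight f →
      ∀ x : ℕ, Real.log (polyHeight f) ^ B ≤ (x : ℝ) →
        ∀ C : ℝ, Literature.NumberTheory.Sieve.HasBatemanHornConst ![f] C →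
          |(primeValueCount f x : ℝ) - C * invLogSum f x| ≤ ε * (C * invLogSum f x)

/-- Shrinking the range preserves uniformity: for `B ≤ B'`, `UniformHypothesisHLogPower d B`
implies `UniformHypothesisHLogPower d B'` (raise the height threshold to `e`, so that
`log h(f) ≥ 1` and `(log h)^B ≤ (log h)^{B'}`). Consequently the set of exponents at which
uniformity FAILS is downward closed. [folklore] -/
theorem UniformHypothesisHLogPower.mono {d : ℕ} {B B' : ℝ} (h : UniformHypothesisHLogPower d B)
    (hBB' : B ≤ B') : UniformHypothesisHLogPower d B' := by
  intro ε hε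
  obtain ⟨h₀, H⟩ := h ε hε
  refine ⟨max h₀ (Real.exp 1), fun f hfd hfi hfp hh x hx C hC => ?_⟩
  have hh₀ : h₀ ≤ polyHeight f := (le_max_left _ _).trans hh
  have hlog : 1 ≤ Real.log (polyHeight f) := by
    have he : Real.exp 1 ≤ polyHeight f := (le_max_right _ _).trans hh
    have hpos : 0 < polyHeight f := lt_of_lt_of_le (Real.exp_pos 1) he
    rw [Real.le_log_iff_exp_le hpos]
    exact he
  refine H f hfd hfi hfp hh₀ x (le_trans ?_ hx) C hC
  exact Real.rpow_le_rpow_of_exponent_le hlog hBB'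

/-! ### The barrier -/

/-- **The Bateman–Horn / Hypothesis-H asymptotic is not uniform in the polynomial for
`x ≥ (log h(f))^B`, in any degree** (Friedlander–Granville, *Limitations to the equi-distribution
of primes IV* (1991); Nair–Perelli (1995); as printed in Granville's ICM survey and in the Zbl
reviews). For every degree `d ≥ 1` and every fixed `B > 0` the uniform statement
`UniformHypothesisHLogPower d B` is false: there are `ε > 0` and irreducible polynomials `f` of
degree `d` without fixed prime divisor, of arbitrarily large height, with some
`x ≥ (log h(f))^B` at which `|π_f(x) − C_f E_f(x)| > ε C_f E_f(x)` (`uniformBatemanHornBarrier_iff`).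
Granville: "we do not always get the asymptotically expected number of prime values `f(n)` with
`n ≤ y = log^B h(f)`, for any fixed `B > 0`. In [FG IV] we showed that this is true for polynomials
of arbitrary degree `d`"; Zbl 0736.11049: "for any integer `N ≥ 2`, the formula (*)
`π_F(x) ∼ C_F x / log|F(x)|` cannot hold uniformly for `x ≥ log^N |F|`, even if one fixes the
degree of `F`" (equivalent quantifications: `uniformBatemanHornBarrier_iff_nat`).
[cite: Granville1995Irregularities, "The Maier Matrix for π_F(y)"] [cite: FriedlanderGranville1991, Abstract and Theorem (as reviewed in Zbl 0736.11049)] [cite: NairPerelli1995, (as reported in Granville 1995 and Zbl 0818.11035)]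

BARRIER (D-0021; one line per key):
technique_class: uniform-asymptotics uniformity-in-the-polynomial bateman-horn-uniform hypothesis-h-quantitative cramér-model probabilistic-heuristic random-model maier-matrix log-power-range — any argument whose conclusion is, or implies, `UniformHypothesisHLogPower d B` for some `d ≥ 1`, `B > 0` [cite: FriedlanderGranville1991, (Zbl 0736.11049)].
blocks: the strengthening of `Literature.NumberTheory.Sieve.BatemanHornConjecture` for one irreducible polynomial of degree `d` (for `d = 2`, `f = X² + 1`: `Literature.NumberTheory.Sieve.HardyLittlewoodConjE`) in which `π_f(x) ∼ C_f E_f(x)` is asserted UNIFORMLY over all irreducible `f` of degree `d` without fixed prime divisor in the range `x ≥ (log h(f))^B`, `B` fixed — false for every `d ≥ 1` and every `B > 0` [cite: FriedlanderGranville1991, Theorem (Zbl 0736.11049)] [cite: Granville1995Irregularities, "The Maier Matrix for π_F(y)"]; with it the unmodified probabilistic (Cramér / Hardy–Littlewood) heuristic from which Hypothesis H is derived, read as a uniform prediction: "the 'random-like' behaviour exhibited by primes in many situations does not carry over to all situations. It remains to discover a model that will always accurately predict how primes are distributed" [cite: Granville1995Irregularities, paragraph after the Conjecture]; the degree-one case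 (`f = qt + a`, `n ≤ x/q = log^N` terms: primes in progressions; `f = t + x`: primes in `(x, x + log^B x]`, Maier) is the tree entry `FriedlanderGranvilleUniformityBarrier` [cite: Granville1995Irregularities, (7) and pp. 9–10] [cite: FriedlanderGranville1992, Corollary p. 21].
because: Maier's matrix method transplanted to polynomial values: sifting by the primes `p ≤ z` leaves a proportion `∼ ω(u) y / log z` of `[1, y]`, `y = z^u`, and "`ω(u) − e^{−γ}` oscillates, crossing zero either once or twice in every interval of length 1", so for `y` a power of `log x` and `u` chosen with `ω(u) ≷ e^{−γ}` the sieve prediction for a short range disagrees with the global density; arranging the short ranges as rows of a matrix whose columns are arithmetic progressions (for polynomials: rows `F_{R+i}(j) = j^d + (R+i)P`, `P = ∏_{p ≤ z} p`, `1 ≤ j ≤ y`, the `j`th column lying in the progression `j^d (mod P)`) and counting the primes in the matrix by columns, via the distribution of primes in progressions / prime ideals, forces some row to carry `(1 ± δ_B)` times the expected number of primes [cite: Granville1995Irregularities, "Outline of the Proof", (8)–(10) and "The Maier Matrix for π_F(y)"]; Friedlander–Granville do this for suitably chosen polynomials of each degree ("care must also be exercised in the choice of polynomials"), unconditionally as an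 `Ω`-result and as an `Ω_±`-result under the Riemann hypothesis for the relevant Dedekind zeta functions [cite: FriedlanderGranville1991, (Zbl 0736.11049)]; Nair–Perelli's mean-value theorem `∑_{Y ≤ d ≤ Y+H} |∑_{X ≤ p ≤ 2X} (ρ(d,p) − r(d))| ≪ XH / log^A X` for the root counts of `x^k + Qd` supplies the prime-ideal-theorem input on average, whence "some of the polynomials `F_R(n) = n^d + RP` attain more than, and others attain less than, the number of prime values expected in such a range" [cite: NairPerelli1995, (Zbl 0818.11035)] [cite: Granville1995Irregularities, "The Maier Matrix for π_F(y)"].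
evasions_known: averaged (almost-all-`f`) statements at the very same scale are theorems: for `100%` of Schinzel `n`-tuples / Bouniakowsky polynomials of fixed degree ordered by height, `#{m ≤ (log |P|)^{n+A} : P(m) prime} ≥ (log |P|)^{A/3}`, the least prime value of `100%` of degree-`d` Bouniakowsky polynomials is `≤ |P| (log |P|)^{d+ε}`, and the Bateman–Horn error `|θ_P(x) − 𝔖_P(x) x|` averaged over all `P` of height `≤ H` is `≪ x / √log x` for `(log H)^{A₁} < x ≤ (log H)^{A₂}`, `n < A₁ < A₂` [cite: SkorobogatovSofos2020, Theorems 1.5, 1.9 and Corollary 1.6]; uniformity is conjectured to return for `x > h(F)^ε` (Granville's Conjecture, `GranvilleUniformityConjecture`; "presumably" already when `log x / log log h(F) → ∞`) [cite: Granville1995Irregularities, Conjecture]; for a FIXED polynomial nothing is obstructed — `Literature.NumberTheory.Sieve.BatemanHornConjecture` itself is untouched, only its uniform-in-`f` upgrade at log-power scale fails [cite: Granville1995Irregularities, "The Maier Matrix for π_F(y)"].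
scope_caveats: failure is exhibited only at the scale `x ≍ (log h(f))^B` (inputs polynomially small in the logarithm of the coefficients) and, in the published accounts, for special families (`n^d + RP` with `P` a primorial; Friedlander–Granville's "carefully chosen" polynomials), with an unspecified deviation `δ > 0`; nothing is asserted for `x ≥ h(f)^ε`, nor for any single polynomial [cite: Granville1995Irregularities, "The Maier Matrix for π_F(y)" and Conjecture]; the primary papers (Friedlander–Granville IV, Nair–Perelli) were not available to this entry (paywalled; acquisition requests filed) — the Prop transcribes the statement as printed in Granville's survey and in Zbl 0736.11049 / Zbl 0818.11035, in its weakest reading (the negation of uniformity, one-sided `|deviation| > ε`), with the expected count rendered by the Cramér sum `∑_{n ≤ x} 1/log|f(n)|` where the sources display `x / log|f(x)|`, and with Granville's height `(∑ cᵢ²)^{1/2}` where Friedlander–Granville use the maximum coefficient (immaterial, all `B` being quantified; `uniformBatemanHornBarrier_iff_nat`) [cite: FriedlanderGranville1991, (Zbl 0736.11049)]; the `Ω_±` (two-sided) statements, the number of bad polynomials, and the `k ≥ 2` (several polynomials) versions are NOT transcribed [cite: FriedlanderGranville1991, Abstract].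
status: established -/
def UniformBatemanHornBarrier : Prop :=
  ∀ d : ℕ, 1 ≤ d → ∀ B : ℝ, 0 < B → ¬ UniformHypothesisHLogPower d B

/-- The barrier in the printed `Ω`-form: for every degree `d ≥ 1` and `B > 0` there is `ε > 0`
such that polynomials `f` of degree `d`, irreducible, without fixed prime divisor and of
arbitrarily large height exist with some `x ≥ (log h(f))^B` and Bateman–Horn constant `C_f` at
which `|π_f(x) − C_f E_f(x)| > ε C_f E_f(x)` ("infinitely many different polynomials of given
degree which take either significantly more or significantly less prime values than expected").
Pure logic (`push_neg`). [cite: FriedlanderGranville1991, Abstract] -/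
theorem uniformBatemanHornBarrier_iff :
    UniformBatemanHornBarrier ↔
      ∀ d : ℕ, 1 ≤ d → ∀ B : ℝ, 0 < B → ∃ ε : ℝ, 0 < ε ∧ ∀ h₀ : ℝ, ∃ f : ℤ[X],
        f.natDegree = d ∧ Irreducible f ∧ Literature.NumberTheory.Sieve.HasNoFixedPrimeDivisor ![f] ∧ h₀ ≤ polyHeight f ∧
          ∃ x : ℕ, Real.log (polyHeight f) ^ B ≤ (x : ℝ) ∧ ∃ C : ℝ, Literature.NumberTheory.Sieve.HasBatemanHornConst ![f] C ∧
            ε * (C * invLogSum f x) < |(primeValueCount f x : ℝ) - C * invLogSum f x| := by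
  unfold UniformBatemanHornBarrier UniformHypothesisHLogPower
  push Not
  rfl

/-- The two printed quantifications agree: failure for every real `B > 0` (Granville: "for any
fixed `B > 0`") is equivalent to failure for every integer `N ≥ 2` (Zbl 0736.11049: "for any
integer `N ≥ 2`"), by `UniformHypothesisHLogPower.mono`.
[cite: Granville1995Irregularities, "The Maier Matrix for π_F(y)"] [cite: FriedlanderGranville1991, (Zbl 0736.11049)] -/
theorem uniformBatemanHornBarrier_iff_nat :
    UniformBatemanHornBarrier ↔
      ∀ d : ℕ, 1 ≤ d → ∀ N : ℕ, 2 ≤ N → ¬ UniformHypothesisHLogPower d N := by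
  constructor
  · intro h d hd N hN
    exact h d hd N (by exact_mod_cast lt_of_lt_of_le zero_lt_two hN)
  · intro h d hd B hB hU
    have hBN : B ≤ ((⌈B⌉₊ + 2 : ℕ) : ℝ) := by
      push_cast
      linarith [Nat.le_ceil B]
    exact h d hd (⌈B⌉₊ + 2) (by omega) (hU.mono hBN)

/-! ### Granville's positive conjecture (open) and its position relative to the barrier -/

/-- OPEN CONJECTURE — **Granville's uniformity conjecture for Hypothesis H**, POSED (as a
"prediction") at the end of A. Granville, *Unexpected irregularities in the distribution of prime
numbers*, Proc. ICM Zürich 1994, Vol. I, Birkhäuser 1995, 388–399: printed p. 397, author's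
version p. 10 [cite: Granville1995Irregularities, Conjecture] [status: open]: "We have now seen
that the asymptotic formula in Hypothesis H fails when `x` is an arbitrary fixed power of
`log h(F)` (`:= ∑ᵢ log h(fᵢ)`), for many different non-trivial examples `F`. Presumably the
asymptotic formula does hold uniformly as `log x / log log h(F) → ∞`. However, to be safe, we only
make the following prediction: **Conjecture.** Fix `ε > 0` and positive integer `k`. The
asymptotic formula in Hypothesis H holds uniformly for `x > h(F)^ε` as `h(F) → ∞`." A CONJECTURE
where it is printed, proved nowhere: already its case `k = 1` contains Bunyakovsky's conjecture
(`GranvilleUniformityConjecture.bunyakovskyConjecture`, sibling `UniformBatemanHornBunyakovsky.lean`;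
"it is not known that any polynomial of degree `≥ 2` takes on infinitely many prime values"
[cite: Granville1995Irregularities, "The Maier Matrix for π_F(y)"]) and, in degree one, a prime in
every interval `(N, N + N^η]` and the prime number theorem for the progressions `b (mod q)`
uniformly in `q < X^{1−δ}` (`GranvilleUniformityConjecture.exists_prime_mem_Ioc`,
`GranvilleUniformityConjecture.primeCounting_progression`, sibling `UniformBatemanHornProofs.lean`),
which Granville's survey likewise only conjectures ((5) for `y > x^ε`, (8) for `q < x^{1−ε}`).
Hence there is no `GranvilleUniformityConjecture_holds`: this is a registered OPEN STATEMENT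
(CONVENTIONS §4: open conjectures are `def …Conjecture : Prop`, never asserted as theorems), not
dischargeable named-fact debt (verdict clean-up 2026-08-16); use it only as an explicit
hypothesis `(h : GranvilleUniformityConjecture)`. Lean rendering (the case `k = 1`, one
irreducible polynomial of fixed degree, in the notation of this file; faithful to the printed
statement in its weakest reading): for every degree `d ≥ 1`, every `η > 0` (Granville's `ε`) and
every `ε > 0` there is `h₀` such that all irreducible `f` of degree `d` without fixed prime
divisor and height `h(f) ≥ h₀`, all `x ≥ h(f)^η` and the Bateman–Horn constant `C_f` satisfy
`|π_f(x) − C_f E_f(x)| ≤ ε C_f E_f(x)`. It marks the range NOT covered by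
`UniformBatemanHornBarrier` (proved comparison `UniformHypothesisHLogPower.of_logPower_range`
below); the `k ≥ 2` (several polynomials) version is not transcribed. Name kept: it already
carries the suffix `Conjecture` (users in the sibling files `UniformBatemanHornProofs.lean`,
`UniformBatemanHornBunyakovsky.lean`). -/
@[conjecture] def GranvilleUniformityConjecture : Prop :=
  ∀ d : ℕ, 1 ≤ d → ∀ η : ℝ, 0 < η → ∀ ε : ℝ, 0 < ε → ∃ h₀ : ℝ, ∀ f : ℤ[X], f.natDegree = d →
    Irreducible f → Literature.NumberTheory.Sieve.HasNoFixedPrimeDivisor ![f] → h₀ ≤ polyHeight f →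
      ∀ x : ℕ, polyHeight f ^ η ≤ (x : ℝ) →
        ∀ C : ℝ, Literature.NumberTheory.Sieve.HasBatemanHornConst ![f] C →
          |(primeValueCount f x : ℝ) - C * invLogSum f x| ≤ ε * (C * invLogSum f x)

/-- The log-power range contains the power range for large heights (`(log h)^B ≤ h^η` once `h`
is large), so uniformity in the sense of `UniformHypothesisHLogPower d B` for a single `B > 0`
would imply the degree-`d` case of `GranvilleUniformityConjecture` for every `η > 0`. Hence the
barrier (which denies the hypothesis) and Granville's conjecture concern different regimes, and
the conjecture is the weaker demand. [cite: Granville1995Irregularities, Conjecture] -/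
theorem UniformHypothesisHLogPower.of_logPower_range {d : ℕ} {B : ℝ}
    (h : UniformHypothesisHLogPower d B) {η : ℝ} (hη : 0 < η) (ε : ℝ) (hε : 0 < ε) :
    ∃ h₀ : ℝ, ∀ f : ℤ[X], f.natDegree = d → Irreducible f → Literature.NumberTheory.Sieve.HasNoFixedPrimeDivisor ![f] →
      h₀ ≤ polyHeight f → ∀ x : ℕ, polyHeight f ^ η ≤ (x : ℝ) →
        ∀ C : ℝ, Literature.NumberTheory.Sieve.HasBatemanHornConst ![f] C →
          |(primeValueCount f x : ℝ) - C * invLogSum f x| ≤ ε * (C * invLogSum f x) := by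
  obtain ⟨h₀, H⟩ := h ε hε
  -- `(log t)^B ≤ t^η` for `t ≥ T`
  obtain ⟨T, hT⟩ : ∃ T : ℝ, ∀ t : ℝ, T ≤ t → Real.log t ^ B ≤ t ^ η := by
    have hlo := (isLittleO_log_rpow_rpow_atTop B hη).bound one_pos
    obtain ⟨T, hT'⟩ := eventually_atTop.mp hlo
    refine ⟨max T 1, fun t ht => ?_⟩
    have ht1 : 1 ≤ t := (le_max_right T 1).trans ht
    have h1 : ‖Real.log t ^ B‖ ≤ 1 * ‖t ^ η‖ := hT' t ((le_max_left T 1).trans ht)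
    rw [one_mul, Real.norm_eq_abs, Real.norm_eq_abs,
      abs_of_nonneg (Real.rpow_nonneg (by linarith) η)] at h1
    exact (le_abs_self _).trans h1
  refine ⟨max h₀ T, fun f hfd hfi hfp hh x hx C hC => ?_⟩
  exact H f hfd hfi hfp ((le_max_left _ _).trans hh) x
    ((hT _ ((le_max_right _ _).trans hh)).trans hx) C hC

/-- In particular `GranvilleUniformityConjecture` would follow from log-power uniformity in every
degree (any one exponent `B(d) > 0` per degree) — the hypothesis that `UniformBatemanHornBarrier`
denies. [cite: Granville1995Irregularities, Conjecture] -/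
theorem granvilleUniformityConjecture_of_logPower
    (h : ∀ d : ℕ, 1 ≤ d → ∃ B : ℝ, UniformHypothesisHLogPower d B) :
    GranvilleUniformityConjecture := by
  intro d hd η hη ε hε
  obtain ⟨B, hB⟩ := h d hd
  exact hB.of_logPower_range hη ε hε

end Literature.Barriers.Parity
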